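import Literature.Analysis.FluidPDE.TorusNSGevreyBalance
import Literature.Analysis.FunctionSpaces.TorusClassicalNSGluing
import Mathlib.MeasureTheory.Integral.IntervalIntegral.FundThmCalculus
import Mathlib.MeasureTheory.Integral.DominatedConvergence
import HarnessLib

/-!
# Gevrey-class smoothing of classical Navier–Stokes solutions on `T³` (Foias–Temam): the bootstrap

Analysis/FluidPDE proof file (theorems only), last of the files proving the Gevrey-class
smoothing estimate of Foias–Temam (J. Funct. Anal. 87 (1989), Thm 1.1, periodic case) for
classical solutions of the Navier–Stokes system on `T^d`, `card d ≤ 3`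
(`TorusNSGevreyLattice`, `…Coefficients`, `…Sums`, `…Balance`). Main theorem
`Torus.IsClassicalNSSolutionOn.gevrey_of_gradNormSq_le`: for `ν > 0`, an enstrophy level `E₁`, a
window length `τ > 0` and a Gevrey level `F` of the force there are `σ > 0` and `C` such that every
classical solution on `[a, a + τ] × T^d` with zero-mean slices, `‖∇u(t)‖₂² ≤ E₁` on the window and
`∑_{|k|≤R} e^{2τ|k|} |k|² ‖f̂(t,k)‖² ≤ F` satisfies `∑_{k ∈ S} e^{2σ|k|} ‖û(a+τ,k)‖² ≤ C` for every
finite `S` — the a-priori form of Gevrey regularity (uniform in `a` and in the solution), the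
interior-regularity tool of the `V`-theory of strong solutions.

Steps. (1) The differential inequality of `TorusNSGevreyBalance` holds for the FINITE partial sums
`Y_R(t) = ∑_{ball R} e_k(t)² |k|² ‖û(t,k)‖²` of the truncated Gevrey enstrophy (weights
`e_k(t) = exp((t−t₀) min(|k|,N))`), with the full sums `Y`, `Z` on the right:
`Y_R' ≤ −(5/4)κ Z_R + (κ/4) Z + G` while `Y ≤` (level). `NSGevrey.gevrey_two_level_of_balance`
integrates it on `[t₀, s]` (level `M`) and `[s, t]` (an a-priori level `Λ'`) by the fundamental
theorem of calculus in inequality form and lets `R → ∞` (`Y_R → Y` pointwise, `∫ Z_R → ∫ Z` by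
dominated convergence with the uniform bound of `Z` on the window from joint smoothness), so that
`−(5/4)κ∫Z_R + (κ/4)∫Z → −κ∫Z ≤ 0` drops out: `Y(t) ≤ Y(t₀) + (s − t₀) G + (t − s) G'` whenever
`Y ≤ M` on `[t₀, s)`. (2) This is the hypothesis of the discrete bootstrap
`NSGevrey.le_of_two_level_bound`; with `t₀ = a + τ − σ`, `σ = min τ (1/(G+1))`, `Y(t₀) ≤ (4π²)⁻¹E₁`
(unit weights at `t₀`) it gives `Y ≤ (4π²)⁻¹E₁ + 2` on `[t₀, a + τ]` for every `N`. (3) On a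
finite `S` the truncated weights at `N ≥ max_S |k|` are the full Gevrey weights `e^{2σ|k|}`.

## Mathlib / tree search

Mathlib: `intervalIntegral.sub_le_integral_of_hasDeriv_right_of_le_Ico`,
`intervalIntegral.tendsto_integral_filter_of_dominated_convergence`,
`intervalIntegral.integral_add_adjacent_intervals`, `aestronglyMeasurable_of_tendsto_ae`,
`IntegrableOn.of_bound`, `le_of_tendsto_of_tendsto'`. Tree: `NSGevrey.*`, the FTC template
`IsClassicalNSSolutionOn.enstrophy_lifespan` (`TorusClassicalNSEnstrophyLifespan`),
`IsClassicalNSSolutionOn.mono` (`TorusClassicalNSGluing`). No Gevrey / analyticity-radius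
smoothing theorem for Navier–Stokes existed in the tree.

Reference: C. Foias, R. Temam, *Gevrey class regularity for the solutions of the Navier–Stokes
equations*, J. Funct. Anal. 87 (1989) 359–369, Thm 1.1 and its proof ((2.15)–(2.17)). [FoiasTemam1989]
-/

noncomputable section

open MeasureTheory Set Filter UnitAddTorus Function Finset intervalIntegral
open scoped Topology BigOperators InnerProductSpace

namespace Literature.Analysis.FluidPDE

namespace NSGevrey

open Literature.Analysis.FunctionSpaces Literature.Analysis.FunctionSpaces.Torus

variable {d : Type*} [Fintype d] [DecidableEq d]

/-! ### The truncated Gevrey sums of a jointly smooth field on a window -/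

section Sums

variable {t₀ t₁ : ℝ} {u : ℝ → UnitAddTorus d → EuclideanSpace ℝ d} {N : ℝ}

omit [DecidableEq d] in
/-- On the window `[t₀, t₁]` the truncated weights are bounded: `e_k(r)² ≤ exp((t₁ − t₀) N)²`
for `r ∈ [t₀, t₁]`, `N ≥ 0`. [folklore] -/
theorem exp_sub_mul_min_sq_le (hN : 0 ≤ N) {r : ℝ} (hr : r ∈ Icc t₀ t₁) (k : d → ℤ) :
    Real.exp ((r - t₀) * min (Real.sqrt (freqNormSq k)) N) ^ 2 ≤ Real.exp ((t₁ - t₀) * N) ^ 2 := by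
  refine pow_le_pow_left₀ (Real.exp_pos _).le (Real.exp_le_exp.2 ?_) 2
  exact mul_le_mul (sub_le_sub_right hr.2 _) (min_le_right _ _)
    (le_min (Real.sqrt_nonneg _) hN) (by linarith [hr.1, hr.2])

/-- Summability and convergence of the partial sums of the truncated Gevrey sums of a smooth slice
(weights `e_k(r)`, `r ∈ [t₀, t₁]`, moment `|k|²ʲ`, `j = 1, 2` encoded by `c = freqNormSq` or
`freqNormSq ^ 2`): the second moment. [folklore] -/
theorem summable_exp_sq_mul_freqNormSq_sq_mul (hu : IsSmoothSpaceTimeOn (Icc t₀ t₁) u) (hN : 0 ≤ N)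
    {r : ℝ} (hr : r ∈ Icc t₀ t₁) :
    (Summable fun k : d → ℤ => Real.exp ((r - t₀) * min (Real.sqrt (freqNormSq k)) N) ^ 2 *
      (freqNormSq k ^ 2 * ‖mFourierCoeff (EuclideanSpace.complexify ∘ u r) k‖ ^ 2)) ∧
    ∑' k : d → ℤ, Real.exp ((r - t₀) * min (Real.sqrt (freqNormSq k)) N) ^ 2 *
        (freqNormSq k ^ 2 * ‖mFourierCoeff (EuclideanSpace.complexify ∘ u r) k‖ ^ 2) ≤
      Real.exp ((t₁ - t₀) * N) ^ 2 * ((4 * Real.pi ^ 2) ^ 2)⁻¹ * ∫ x, ‖Torus.laplacian (u r) x‖ ^ 2 :=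
  summable_weight_mul_freqNormSq_sq_mul (hu.isSmooth_slice hr) (fun _ => sq_nonneg _)
    (fun k => exp_sub_mul_min_sq_le hN hr k)

/-- The first moment: summability and the bound by `exp((t₁−t₀)N)² (4π²)⁻¹ ‖∇u(r)‖₂²`. [folklore] -/
theorem summable_exp_sq_mul_freqNormSq_mul (hu : IsSmoothSpaceTimeOn (Icc t₀ t₁) u) (hN : 0 ≤ N)
    {r : ℝ} (hr : r ∈ Icc t₀ t₁) :
    (Summable fun k : d → ℤ => Real.exp ((r - t₀) * min (Real.sqrt (freqNormSq k)) N) ^ 2 *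
      (freqNormSq k * ‖mFourierCoeff (EuclideanSpace.complexify ∘ u r) k‖ ^ 2)) ∧
    ∑' k : d → ℤ, Real.exp ((r - t₀) * min (Real.sqrt (freqNormSq k)) N) ^ 2 *
        (freqNormSq k * ‖mFourierCoeff (EuclideanSpace.complexify ∘ u r) k‖ ^ 2) ≤
      Real.exp ((t₁ - t₀) * N) ^ 2 * (4 * Real.pi ^ 2)⁻¹ * gradNormSq (u r) :=
  summable_weight_mul_freqNormSq_mul (hu.isSmooth_slice hr) (fun _ => sq_nonneg _)
    (fun k => exp_sub_mul_min_sq_le hN hr k)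

end Sums

/-! ### Integration in time at two levels and the limit `R → ∞` -/

section TwoLevel

variable {t₀ t₁ : ℝ} {u : ℝ → UnitAddTorus d → EuclideanSpace ℝ d} {N : ℝ}

/-- **The integrated two-level Gevrey inequality** (Foias–Temam 1989, proof of Thm 1.1, made
rigorous with truncated weights and partial sums). Let `u` be jointly smooth on `[t₀, t₁] × T^d`,
`t₀ < t₁`, `N ≥ 0`, `κ ≥ 0`, and let `Y, Z` (`Y_R, Z_R`) be the (partial) truncated Gevrey sums of
order `|k|²`, `|k|⁴` with weights `e_k(r) = exp((r − t₀) min(|k|, N))`, `D_R` the time derivative of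
`Y_R` (all entering through their defining equations). Suppose the differential inequality
`D_R(r) ≤ −(5/4)κ Z_R(r) + (κ/4) Z(r) + G` holds whenever `Y(r) ≤ M`, and with `G'` whenever
`Y(r) ≤ Λ'`, where `Y ≤ Λ'` throughout the window (an a-priori level). Then for
`t₀ ≤ s ≤ t ≤ t₁` with `Y ≤ M` on `[t₀, s)`:  `Y(t) ≤ Y(t₀) + (s − t₀) G + (t − s) G'`.
Proof: FTC in inequality form for `Y_R` on `[t₀, s]` and `[s, t]`, then `R → ∞` (`Y_R → Y`,
`∫ Z_R → ∫ Z` by dominated convergence with the uniform bound of `Z` on the window), where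
`−(5/4)κ ∫ Z_R + (κ/4) ∫ Z → −κ ∫ Z ≤ 0`. [cite: FoiasTemam1989, proof of Thm 1.1 (2.15)–(2.17)] -/
theorem gevrey_two_level_of_balance (hu : IsSmoothSpaceTimeOn (Icc t₀ t₁) u) (ht₀₁ : t₀ < t₁)
    (hN : 0 ≤ N) {κ M Λ' G G' : ℝ} (hκ : 0 ≤ κ) {Y Z : ℝ → ℝ} {YR ZR DR : ℕ → ℝ → ℝ}
    (hY : ∀ r, Y r = ∑' k, Real.exp ((r - t₀) * min (Real.sqrt (freqNormSq k)) N) ^ 2 *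
      (freqNormSq k * ‖mFourierCoeff (EuclideanSpace.complexify ∘ u r) k‖ ^ 2))
    (hZ : ∀ r, Z r = ∑' k, Real.exp ((r - t₀) * min (Real.sqrt (freqNormSq k)) N) ^ 2 *
      (freqNormSq k ^ 2 * ‖mFourierCoeff (EuclideanSpace.complexify ∘ u r) k‖ ^ 2))
    (hYR : ∀ R r, YR R r = ∑ k ∈ freqBall R, Real.exp ((r - t₀) * min (Real.sqrt (freqNormSq k)) N) ^ 2 *
      (freqNormSq k * ‖mFourierCoeff (EuclideanSpace.complexify ∘ u r) k‖ ^ 2))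
    (hZR : ∀ R r, ZR R r = ∑ k ∈ freqBall R, Real.exp ((r - t₀) * min (Real.sqrt (freqNormSq k)) N) ^ 2 *
      (freqNormSq k ^ 2 * ‖mFourierCoeff (EuclideanSpace.complexify ∘ u r) k‖ ^ 2))
    (hDR : ∀ R r, DR R r = ∑ k ∈ freqBall R, (2 * min (Real.sqrt (freqNormSq k)) N *
        Real.exp ((r - t₀) * min (Real.sqrt (freqNormSq k)) N) ^ 2 *
          (freqNormSq k * ‖mFourierCoeff (EuclideanSpace.complexify ∘ u r) k‖ ^ 2) +
      Real.exp ((r - t₀) * min (Real.sqrt (freqNormSq k)) N) ^ 2 * (freqNormSq k *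
        (2 * (inner ℂ (mFourierCoeff (EuclideanSpace.complexify ∘ timeDerivWithin (Icc t₀ t₁) u r) k)
          (mFourierCoeff (EuclideanSpace.complexify ∘ u r) k)).re))))
    (hGM : ∀ R, ∀ r ∈ Icc t₀ t₁, Y r ≤ M → DR R r ≤ -(5 / 4 * κ) * ZR R r + κ / 4 * Z r + G)
    (hG' : ∀ R, ∀ r ∈ Icc t₀ t₁, Y r ≤ Λ' → DR R r ≤ -(5 / 4 * κ) * ZR R r + κ / 4 * Z r + G')
    (hap : ∀ r ∈ Icc t₀ t₁, Y r ≤ Λ') {s t : ℝ} (hs : t₀ ≤ s) (hst : s ≤ t) (ht : t ≤ t₁)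
    (hM : ∀ r ∈ Ico t₀ s, Y r ≤ M) :
    Y t ≤ Y t₀ + (s - t₀) * G + (t - s) * G' := by
  have ht₀t : t₀ ≤ t := hs.trans hst
  have hst₁ : s ≤ t₁ := hst.trans ht
  -- summability, pointwise convergence, `0 ≤ Z_R ≤ Z ≤ D₀` on the window
  have hsumY := fun r (hr : r ∈ Icc t₀ t₁) => (summable_exp_sq_mul_freqNormSq_mul hu hN hr).1
  have hsumZ := fun r (hr : r ∈ Icc t₀ t₁) => (summable_exp_sq_mul_freqNormSq_sq_mul hu hN hr).1
  obtain ⟨Dl, -, hDl⟩ := hu.exists_forall_integral_norm_laplacian_sq_le ht₀₁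
  set D₀ : ℝ := Real.exp ((t₁ - t₀) * N) ^ 2 * ((4 * Real.pi ^ 2) ^ 2)⁻¹ * Dl with hD₀
  have hZD : ∀ r ∈ Icc t₀ t₁, Z r ≤ D₀ := fun r hr => by
    rw [hZ]
    exact (summable_exp_sq_mul_freqNormSq_sq_mul hu hN hr).2.trans
      (mul_le_mul_of_nonneg_left (hDl r hr) (by positivity))
  have hZ0 : ∀ r, 0 ≤ Z r := fun r => by rw [hZ]; exact tsum_nonneg fun k => by positivity
  have hZR0 : ∀ R r, 0 ≤ ZR R r := fun R r => by rw [hZR]; exact Finset.sum_nonneg fun k _ => by positivity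
  have hZRZ : ∀ R, ∀ r ∈ Icc t₀ t₁, ZR R r ≤ Z r := fun R r hr => by
    rw [hZR, hZ]; exact sum_freqBall_le_tsum (fun k => by positivity) (hsumZ r hr) R
  have hYlim : ∀ r ∈ Icc t₀ t₁, Tendsto (fun R => YR R r) atTop (𝓝 (Y r)) := fun r hr => by
    rw [hY, show (fun R => YR R r) = fun R => ∑ k ∈ freqBall R, Real.exp ((r - t₀) *
      min (Real.sqrt (freqNormSq k)) N) ^ 2 * (freqNormSq k * ‖mFourierCoeff (EuclideanSpace.complexify ∘ u r) k‖ ^ 2)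
      from funext fun R => hYR R r]
    exact tendsto_sum_freqBall (hsumY r hr)
  have hZlim : ∀ r ∈ Icc t₀ t₁, Tendsto (fun R => ZR R r) atTop (𝓝 (Z r)) := fun r hr => by
    rw [hZ, show (fun R => ZR R r) = fun R => ∑ k ∈ freqBall R, Real.exp ((r - t₀) *
      min (Real.sqrt (freqNormSq k)) N) ^ 2 * (freqNormSq k ^ 2 * ‖mFourierCoeff (EuclideanSpace.complexify ∘ u r) k‖ ^ 2)
      from funext fun R => hZR R r]
    exact tendsto_sum_freqBall (hsumZ r hr)
  -- continuity of the partial sums, the derivative of `Y_R`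
  have hYRc : ∀ R, ContinuousOn (YR R) (Icc t₀ t₁) := fun R => by
    rw [show YR R = _ from funext (hYR R)]
    exact continuousOn_sum_exp_sq_mul hu ht₀₁ N (freqBall R) fun k => freqNormSq k
  have hZRc : ∀ R, ContinuousOn (ZR R) (Icc t₀ t₁) := fun R => by
    rw [show ZR R = _ from funext (hZR R)]
    exact continuousOn_sum_exp_sq_mul hu ht₀₁ N (freqBall R) fun k => freqNormSq k ^ 2
  have hder : ∀ R, ∀ r ∈ Icc t₀ t₁, HasDerivWithinAt (YR R) (DR R r) (Icc t₀ t₁) r := fun R r hr => by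
    rw [show YR R = _ from funext (hYR R), hDR]
    exact hasDerivWithinAt_sum_exp_sq_mul_freqNormSq_mul hu ht₀₁ N R hr
  have hderI : ∀ R, ∀ r ∈ Ico t₀ t₁, HasDerivWithinAt (YR R) (DR R r) (Ioi r) r := fun R r hr =>
    (((hder R r (Ico_subset_Icc_self hr)).mono (Icc_subset_Icc hr.1 le_rfl)).mono_of_mem_nhdsWithin
      (Icc_mem_nhdsGE hr.2)).mono Ioi_subset_Ici_self
  -- measurability and integrability of `Z` on the window
  have hZm : AEStronglyMeasurable Z (volume.restrict (Icc t₀ t₁)) :=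
    aestronglyMeasurable_of_tendsto_ae atTop (fun R => (hZRc R).aestronglyMeasurable measurableSet_Icc)
      (ae_restrict_of_forall_mem measurableSet_Icc hZlim)
  have hZi : IntegrableOn Z (Icc t₀ t₁) volume :=
    IntegrableOn.of_bound measure_Icc_lt_top hZm D₀ (ae_restrict_of_forall_mem measurableSet_Icc
      fun r hr => by rw [Real.norm_eq_abs, abs_of_nonneg (hZ0 r)]; exact hZD r hr)
  -- FTC in inequality form on `[a, b] ⊆ [t₀, t₁]` at a level `L` with constant `K`
  have hFTC : ∀ (R : ℕ) {a b L K : ℝ}, t₀ ≤ a → a ≤ b → b ≤ t₁ → (∀ r ∈ Ico a b, Y r ≤ L) →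
      (∀ R, ∀ r ∈ Icc t₀ t₁, Y r ≤ L → DR R r ≤ -(5 / 4 * κ) * ZR R r + κ / 4 * Z r + K) →
      YR R b - YR R a ≤ -(5 / 4 * κ) * (∫ r in a..b, ZR R r) + κ / 4 * (∫ r in a..b, Z r) + (b - a) * K := by
    intro R a b L K ha hab hb hL hK
    have hsub : Icc a b ⊆ Icc t₀ t₁ := Icc_subset_Icc ha hb
    have hZRi : IntervalIntegrable (ZR R) volume a b := ((hZRc R).mono hsub).intervalIntegrable_of_Icc hab
    have hZi' : IntervalIntegrable Z volume a b :=
      (intervalIntegrable_iff_integrableOn_Icc_of_le hab).2 (hZi.mono_set hsub)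
    have hφi : IntegrableOn (fun r => -(5 / 4 * κ) * ZR R r + κ / 4 * Z r + K) (Icc a b) volume :=
      ((((hZRc R).mono hsub).integrableOn_Icc.const_mul _).add ((hZi.mono_set hsub).const_mul _)).add
        (continuousOn_const.integrableOn_Icc)
    have hmain := intervalIntegral.sub_le_integral_of_hasDeriv_right_of_le_Ico hab ((hYRc R).mono hsub)
      (fun r hr => hderI R r ⟨ha.trans hr.1, hr.2.trans_le hb⟩) hφi
      (fun r hr => hK R r (hsub (Ico_subset_Icc_self hr)) (hL r hr))
    have hsplit : ∫ r in a..b, (-(5 / 4 * κ) * ZR R r + κ / 4 * Z r + K) =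
        -(5 / 4 * κ) * (∫ r in a..b, ZR R r) + κ / 4 * (∫ r in a..b, Z r) + (b - a) * K := by
      rw [intervalIntegral.integral_add ((hZRi.const_mul _).add (hZi'.const_mul _)) intervalIntegrable_const,
        intervalIntegral.integral_add (hZRi.const_mul _) (hZi'.const_mul _),
        intervalIntegral.integral_const_mul, intervalIntegral.integral_const_mul,
        intervalIntegral.integral_const, smul_eq_mul]
    rwa [hsplit] at hmain
  -- the inequality at finite `R`
  have hR : ∀ R : ℕ, YR R t - YR R t₀ ≤ -(5 / 4 * κ) * (∫ r in t₀..t, ZR R r) +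
      κ / 4 * (∫ r in t₀..t, Z r) + ((s - t₀) * G + (t - s) * G') := by
    intro R
    have h1 := hFTC R le_rfl hs hst₁ hM hGM
    have h2 := hFTC R hs hst ht (fun r hr => hap r ⟨hs.trans hr.1, (hr.2.le.trans ht)⟩) hG'
    have hZRi : ∀ a b, t₀ ≤ a → a ≤ b → b ≤ t₁ → IntervalIntegrable (ZR R) volume a b := fun a b ha hab hb =>
      ((hZRc R).mono (Icc_subset_Icc ha hb)).intervalIntegrable_of_Icc hab
    have hZi' : ∀ a b, t₀ ≤ a → a ≤ b → b ≤ t₁ → IntervalIntegrable Z volume a b := fun a b ha hab hb =>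
      (intervalIntegrable_iff_integrableOn_Icc_of_le hab).2 (hZi.mono_set (Icc_subset_Icc ha hb))
    rw [← intervalIntegral.integral_add_adjacent_intervals (hZRi t₀ s le_rfl hs hst₁) (hZRi s t hs hst ht),
      ← intervalIntegral.integral_add_adjacent_intervals (hZi' t₀ s le_rfl hs hst₁) (hZi' s t hs hst ht)]
    linarith
  -- the limit `R → ∞`
  have hlimI : Tendsto (fun R => ∫ r in t₀..t, ZR R r) atTop (𝓝 (∫ r in t₀..t, Z r)) := by
    refine intervalIntegral.tendsto_integral_filter_of_dominated_convergence (fun _ => D₀)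
      (Eventually.of_forall fun R => ?_) (Eventually.of_forall fun R => ae_of_all _ fun r hr => ?_)
      intervalIntegrable_const (ae_of_all _ fun r hr => ?_)
    · rw [uIoc_of_le ht₀t]
      exact ((hZRc R).mono (Ioc_subset_Icc_self.trans (Icc_subset_Icc le_rfl ht))).aestronglyMeasurable
        measurableSet_Ioc
    · rw [uIoc_of_le ht₀t] at hr
      have hr' : r ∈ Icc t₀ t₁ := ⟨hr.1.le, hr.2.trans ht⟩
      rw [Real.norm_eq_abs, abs_of_nonneg (hZR0 R r)]
      exact (hZRZ R r hr').trans (hZD r hr')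
    · rw [uIoc_of_le ht₀t] at hr
      exact hZlim r ⟨hr.1.le, hr.2.trans ht⟩
  have hL : Tendsto (fun R => YR R t - YR R t₀) atTop (𝓝 (Y t - Y t₀)) :=
    (hYlim t ⟨ht₀t, ht⟩).sub (hYlim t₀ ⟨le_rfl, ht₀₁.le⟩)
  have hRlim : Tendsto (fun R => -(5 / 4 * κ) * (∫ r in t₀..t, ZR R r) + κ / 4 * (∫ r in t₀..t, Z r) +
      ((s - t₀) * G + (t - s) * G')) atTop
      (𝓝 (-(5 / 4 * κ) * (∫ r in t₀..t, Z r) + κ / 4 * (∫ r in t₀..t, Z r) + ((s - t₀) * G + (t - s) * G'))) :=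
    ((hlimI.const_mul _).add tendsto_const_nhds).add tendsto_const_nhds
  have hle := le_of_tendsto_of_tendsto' hL hRlim hR
  have hI0 : 0 ≤ ∫ r in t₀..t, Z r := intervalIntegral.integral_nonneg ht₀t fun r _ => hZ0 r
  nlinarith [hle, hI0, hκ]

end TwoLevel

/-! ### The Gevrey-class smoothing theorem -/

section Main

/-- **Gevrey-class smoothing of classical Navier–Stokes solutions with bounded enstrophy**
(Foias–Temam 1989, Thm 1.1, periodic case, in a-priori form). On `T^d`, `card d ≤ 3`, let
`ν > 0`, an enstrophy level `E₁`, a window length `τ > 0` and a Gevrey level `F` of the force be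
given. There are a radius `σ > 0` and a bound `C` such that for EVERY classical solution `(u, p)`
of the Navier–Stokes system with force `f` on `[a, a + τ] × T^d` whose slices have zero mean and
enstrophy `‖∇u(t)‖₂² ≤ E₁` on the window, and whose force satisfies
`∑_{|k| ≤ R} e^{2τ|k|} |k|² ‖f̂(t,k)‖² ≤ F` (all `t`, `R`; e.g. a trigonometric polynomial), the
final slice is in the Gevrey class `∑_{k ∈ S} e^{2σ|k|} ‖û(a + τ, k)‖² ≤ C` for every finite `S`
(hence `∑ₖ e^{2σ|k|} ‖û(a+τ,k)‖² ≤ C`). Proof: on `[t₀, a + τ]`, `t₀ = a + τ − σ`, the truncated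
Gevrey enstrophies `Y^N` start below `(4π²)⁻¹E₁`, satisfy the two-level integral inequality
`NSGevrey.gevrey_two_level_of_balance` (constants from
`IsClassicalNSSolutionOn.exists_gevreyBalance_bound`), hence stay `≤ M` by the bootstrap
`NSGevrey.le_of_two_level_bound`, uniformly in `N`; let `N → ∞` on the finite set `S`.
[cite: FoiasTemam1989, Thm 1.1] -/
theorem _root_.Literature.Analysis.FunctionSpaces.Torus.IsClassicalNSSolutionOn.gevrey_of_gradNormSq_le
    [Nonempty d] (hd : Fintype.card d ≤ 3) {ν : ℝ} (hν : 0 < ν) (E₁ τ F : ℝ) (hτ : 0 < τ) :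
    ∃ σ : ℝ, 0 < σ ∧ ∃ C : ℝ, ∀ {a : ℝ} {f u : ℝ → UnitAddTorus d → EuclideanSpace ℝ d}
      {p : ℝ → UnitAddTorus d → ℝ}, IsClassicalNSSolutionOn (Icc a (a + τ)) ν f u p →
      (∀ t ∈ Icc a (a + τ), HasZeroMean (u t)) → (∀ t ∈ Icc a (a + τ), gradNormSq (u t) ≤ E₁) →
      (∀ t ∈ Icc a (a + τ), ∀ R : ℕ, ∑ k ∈ freqBall R, Real.exp (τ * Real.sqrt (freqNormSq k)) ^ 2 *
        (freqNormSq k * ‖mFourierCoeff (EuclideanSpace.complexify ∘ f t) k‖ ^ 2) ≤ F) →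
      ∀ S : Finset (d → ℤ), ∑ k ∈ S, Real.exp (2 * σ * Real.sqrt (freqNormSq k)) *
        ‖mFourierCoeff (EuclideanSpace.complexify ∘ u (a + τ)) k‖ ^ 2 ≤ C := by
  -- constants
  set F' : ℝ := max F 0 with hF'
  set y₀ : ℝ := (4 * Real.pi ^ 2)⁻¹ * max E₁ 0 with hy₀
  have hy₀0 : 0 ≤ y₀ := by positivity
  set M : ℝ := y₀ + 2 with hM
  obtain ⟨G, hG0, hG⟩ := IsClassicalNSSolutionOn.exists_gevreyBalance_bound (d := d) hd hν
    (Λ := M) (F := F') (by positivity) (le_max_right _ _)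
  set T₂ : ℝ := min τ (1 / (G + 1)) with hT₂
  have hG1 : 0 < G + 1 := by linarith
  have hT₂0 : 0 < T₂ := lt_min hτ (by positivity)
  have hT₂τ : T₂ ≤ τ := min_le_left _ _
  have hT₂G : T₂ * G ≤ 1 := by
    calc T₂ * G ≤ 1 / (G + 1) * G := mul_le_mul_of_nonneg_right (min_le_right _ _) hG0
      _ ≤ 1 := by rw [div_mul_eq_mul_div, one_mul, div_le_one hG1]; linarith
  refine ⟨T₂, hT₂0, M, fun {a f u p} h hzm hE hforce S => ?_⟩
  -- the window `[t₀, t₁]`, `t₁ = a + τ`, `t₀ = t₁ - T₂`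
  set t₁ : ℝ := a + τ with ht₁
  set t₀ : ℝ := a + τ - T₂ with ht₀
  have ht₀₁ : t₀ < t₁ := by rw [ht₀, ht₁]; linarith
  have hlen : t₁ - t₀ = T₂ := by rw [ht₀, ht₁]; ring
  have hsub : Icc t₀ t₁ ⊆ Icc a (a + τ) := Icc_subset_Icc (by rw [ht₀]; linarith) le_rfl
  have h' : IsClassicalNSSolutionOn (Icc t₀ t₁) ν f u p := h.mono hsub (uniqueDiffOn_Icc ht₀₁)
  have hu : IsSmoothSpaceTimeOn (Icc t₀ t₁) u := h'.smooth_velocity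
  have hzm' : ∀ t ∈ Icc t₀ t₁, HasZeroMean (u t) := fun t ht => hzm t (hsub ht)
  have hforce' : ∀ t ∈ Icc t₀ t₁, ∀ R : ℕ, ∑ k ∈ freqBall R, Real.exp ((t₁ - t₀) * Real.sqrt (freqNormSq k)) ^ 2 *
      (freqNormSq k * ‖mFourierCoeff (EuclideanSpace.complexify ∘ f t) k‖ ^ 2) ≤ F' := by
    intro t ht R
    refine le_trans (Finset.sum_le_sum fun k _ => ?_) ((hforce t (hsub ht) R).trans (le_max_left _ _))
    refine mul_le_mul_of_nonneg_right (pow_le_pow_left₀ (Real.exp_pos _).le (Real.exp_le_exp.2 ?_) 2)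
      (mul_nonneg (freqNormSq_nonneg k) (sq_nonneg _))
    rw [hlen]
    exact mul_le_mul_of_nonneg_right hT₂τ (Real.sqrt_nonneg _)
  -- the truncation parameter: `S` inside the ball of radius `N`
  set N : ℝ := (∑ k ∈ S, freqNormSq k) + 1 with hN
  have hN0 : 0 ≤ N := by
    have : 0 ≤ ∑ k ∈ S, freqNormSq k := Finset.sum_nonneg fun k _ => freqNormSq_nonneg k
    linarith
  have hSN : ∀ k ∈ S, Real.sqrt (freqNormSq k) ≤ N := by
    intro k hk
    have h1 : freqNormSq k ≤ ∑ j ∈ S, freqNormSq j :=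
      Finset.single_le_sum (f := fun j => freqNormSq j) (fun j _ => freqNormSq_nonneg j) hk
    have h2 : Real.sqrt (freqNormSq k) ≤ freqNormSq k + 1 := by
      rw [Real.sqrt_le_left (by linarith [freqNormSq_nonneg k])]
      nlinarith [freqNormSq_nonneg k]
    linarith
  -- the sums
  set Y : ℝ → ℝ := fun r => ∑' k, Real.exp ((r - t₀) * min (Real.sqrt (freqNormSq k)) N) ^ 2 *
    (freqNormSq k * ‖mFourierCoeff (EuclideanSpace.complexify ∘ u r) k‖ ^ 2) with hY
  -- a-priori level
  set Λ' : ℝ := Real.exp ((t₁ - t₀) * N) ^ 2 * (4 * Real.pi ^ 2)⁻¹ * max E₁ 0 with hΛ'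
  have hap : ∀ r ∈ Icc t₀ t₁, Y r ≤ Λ' := fun r hr =>
    (summable_exp_sq_mul_freqNormSq_mul hu hN0 hr).2.trans (mul_le_mul_of_nonneg_left
      ((hE r (hsub hr)).trans (le_max_left _ _)) (by positivity))
  obtain ⟨G', hG'0, hG'⟩ := IsClassicalNSSolutionOn.exists_gevreyBalance_bound (d := d) hd hν
    (Λ := Λ') (F := F') (by positivity) (le_max_right _ _)
  -- the two-level inequality and the bootstrap: `Y ≤ M` on the window
  have hκ : (0 : ℝ) ≤ 4 * Real.pi ^ 2 * ν := by positivity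
  have hYM : ∀ t ∈ Icc t₀ t₁, Y t ≤ M := by
    refine le_of_two_level_bound (y := Y) (y₀ := Y t₀) hG0 hG'0 ?_ fun s t hs hst ht hMs => ?_
    · -- `Y t₀ ≤ y₀` (unit weights at `t₀`) and `(t₁ - t₀) G ≤ 1`
      have h1 := (summable_weight_mul_freqNormSq_mul (hu.isSmooth_slice ⟨le_rfl, ht₀₁.le⟩)
        (w := fun k => Real.exp ((t₀ - t₀) * min (Real.sqrt (freqNormSq k)) N) ^ 2) (W := 1)
        (fun _ => sq_nonneg _) (fun k => by rw [sub_self, zero_mul, Real.exp_zero, one_pow])).2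
      have h2 : Y t₀ ≤ y₀ := h1.trans (by
        rw [one_mul, hy₀]
        exact mul_le_mul_of_nonneg_left ((hE t₀ (hsub ⟨le_rfl, ht₀₁.le⟩)).trans (le_max_left _ _))
          (by positivity))
      rw [hlen, hM]
      linarith
    · exact gevrey_two_level_of_balance hu ht₀₁ hN0 hκ (fun r => rfl) (fun r => rfl) (fun R r => rfl)
        (fun R r => rfl) (fun R r => rfl)
        (fun R r hr hYr => hG h' ht₀₁ hzm' hforce' R hN0 hr hYr)
        (fun R r hr hYr => hG' h' ht₀₁ hzm' hforce' R hN0 hr hYr) hap hs hst ht hMs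
  -- at the final time, on the finite set `S`, the truncated weights are the full Gevrey weights
  have hfin := hYM t₁ ⟨ht₀₁.le, le_rfl⟩
  have hsumm := (summable_exp_sq_mul_freqNormSq_mul hu hN0 ⟨ht₀₁.le, le_rfl⟩).1
  have hut₁ : IsSmooth (u t₁) := hu.isSmooth_slice ⟨ht₀₁.le, le_rfl⟩
  refine le_trans ?_ ((hsumm.sum_le_tsum S fun k _ => mul_nonneg (sq_nonneg _)
    (mul_nonneg (freqNormSq_nonneg k) (sq_nonneg _))).trans hfin)
  refine Finset.sum_le_sum fun k hk => ?_
  rw [min_eq_left (hSN k hk), hlen, ← Real.exp_nat_mul, Nat.cast_ofNat,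
    show 2 * (T₂ * Real.sqrt (freqNormSq k)) = 2 * T₂ * Real.sqrt (freqNormSq k) by ring]
  by_cases hk0 : k = 0
  · rw [hk0, mFourierCoeff_complexify_zero_of_hasZeroMean hut₁.integrable (hzm' t₁ ⟨ht₀₁.le, le_rfl⟩)]
    simp
  · have h1 : 1 ≤ freqNormSq k := one_le_freqNormSq_of_ne_zero hk0
    have hw : 0 ≤ Real.exp (2 * T₂ * Real.sqrt (freqNormSq k)) *
        ‖mFourierCoeff (EuclideanSpace.complexify ∘ u t₁) k‖ ^ 2 := by positivity
    calc Real.exp (2 * T₂ * Real.sqrt (freqNormSq k)) * ‖mFourierCoeff (EuclideanSpace.complexify ∘ u t₁) k‖ ^ 2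
        = 1 * (Real.exp (2 * T₂ * Real.sqrt (freqNormSq k)) *
            ‖mFourierCoeff (EuclideanSpace.complexify ∘ u t₁) k‖ ^ 2) := (one_mul _).symm
      _ ≤ freqNormSq k * (Real.exp (2 * T₂ * Real.sqrt (freqNormSq k)) *
            ‖mFourierCoeff (EuclideanSpace.complexify ∘ u t₁) k‖ ^ 2) := mul_le_mul_of_nonneg_right h1 hw
      _ = _ := by ring

end Main

end NSGevrey

end Literature.Analysis.FluidPDE
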